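import Literature.NumberTheory.Sieve.KloostermanQuintilinearWeights5D
import HarnessLib

/-!
# The concrete weights of Drappeau 2017, §5.5: plateau functions, dilations, the `α`-profile

Topic `Literature/NumberTheory/Sieve`.  Instances of the pointwise derivative bounds (`DerivBound`,
`KloostermanQuintilinearDerivBounds.lean`) for the concrete one-variable factors from which the
five-variable weight of Drappeau 2017, §5.5 is built, in the format consumed by
`norm_mixedDeriv_le_rpow` (`…Weights5D.lean`):

* `DerivBound.sub`, `derivBound_comp_mul_pt` — differences; dilations of pointwise bounds;
* `derivBound_bumpC_dilate` — `c ↦ γ(q₀c)`, `γ = BFI.bumpC S Y`: bounds `(2·derivConstSum k, ((2S+Y)/Y)/c)`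
  at every `c > 0` (vanishing outside `[S−Y, 2S+Y]/q₀`, the global bound `(q₀/Y)^i` inside);
* `derivBound_bumpC_plateau` — the cut-offs `BFI.bumpC M (M/2)`: bounds `(2·derivConstSum k, 5/t)`;
* `bumpC_eventuallyEq_zero_of_lt`, `…_of_gt` — vanishing near points off `[M−Y, 2M+Y]`;
* `exists_MQ_bumpC` — a family `MQ k` bounding `‖(t^m α^{(m)})^{(l)}‖` (`m, l ≤ k`) for the profile
  `α = BFI.bumpC 1 (1/2)`, which vanishes on `[5/2, ∞)` (`bumpC_one_half_eq_zero_of_ge`).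

Everything is proved; no definition, no named fact.

## References

* S. Drappeau, Proc. London Math. Soc. (3) 114 (2017) 684–732, arXiv:1504.05549, §5.2 (the
  weights `γ`, `α`) and §5.5. [cite: Drappeau2017, §5.5]
-/

noncomputable section

open scoped ContDiff Topology
open Filter Finset

namespace Literature.NumberTheory.Sieve

namespace KloostermanQuintilinear

/-! ### Differences and dilations -/

/-- Differences: bounds `(X, u)` and `(X', u)` give `(X + X', u)` for `f − g`. [folklore] -/
theorem DerivBound.sub {f g : ℝ → ℂ} {x : ℝ} {k : ℕ} {X X' u : ℝ} (hf : ContDiff ℝ ∞ f)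
    (hg : ContDiff ℝ ∞ g) (h₁ : DerivBound f x k X u) (h₂ : DerivBound g x k X' u) :
    DerivBound (fun t => f t - g t) x k (X + X') u := by
  intro i hi
  have hfi : ContDiffAt ℝ i f x := (hf.of_le (by exact_mod_cast le_top)).contDiffAt
  have hgi : ContDiffAt ℝ i g x := (hg.of_le (by exact_mod_cast le_top)).contDiffAt
  have e : (fun t => f t - g t) = f - g := rfl
  rw [e, iteratedDeriv_sub hfi hgi]
  calc ‖iteratedDeriv i f x - iteratedDeriv i g x‖ ≤ ‖iteratedDeriv i f x‖ + ‖iteratedDeriv i g x‖ :=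
        norm_sub_le _ _
    _ ≤ X * u ^ i + X' * u ^ i := add_le_add (h₁ i hi) (h₂ i hi)
    _ = (X + X') * u ^ i := by ring

/-- Dilations of a pointwise bound: `DerivBound Q (a x) k X u` gives
`DerivBound (Q(a·)) x k X (|a| u)`. [folklore] -/
theorem derivBound_comp_mul_pt {Q : ℝ → ℂ} (hQ : ContDiff ℝ ∞ Q) {k : ℕ} {X u : ℝ} (a x : ℝ)
    (h : DerivBound Q (a * x) k X u) : DerivBound (fun t => Q (a * t)) x k X (|a| * u) := by
  intro i hi
  have hd := iteratedDeriv_comp_const_smul (n := i) (hQ.of_le (by exact_mod_cast le_top)) a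
  rw [hd]
  simp only
  rw [norm_smul, norm_pow, Real.norm_eq_abs, mul_pow, mul_left_comm]
  exact mul_le_mul_of_nonneg_left (h i hi) (by positivity)

/-! ### The plateau functions `BFI.bumpC` near points off their support -/

/-- `bumpC M Y` vanishes near every `t < M − Y`. [folklore] -/
theorem bumpC_eventuallyEq_zero_of_lt {M Y t : ℝ} (hY : 0 < Y) (hM : 0 ≤ M) (ht : t < M - Y) :
    BFI.bumpC M Y =ᶠ[𝓝 t] 0 :=
  Filter.eventually_of_mem (Iio_mem_nhds ht) fun _ ht' =>
    BFI.bumpC_eq_zero hY hM (Or.inl (le_of_lt ht'))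

/-- `bumpC M Y` vanishes near every `t > 2M + Y`. [folklore] -/
theorem bumpC_eventuallyEq_zero_of_gt {M Y t : ℝ} (hY : 0 < Y) (hM : 0 ≤ M) (ht : 2 * M + Y < t) :
    BFI.bumpC M Y =ᶠ[𝓝 t] 0 :=
  Filter.eventually_of_mem (Ioi_mem_nhds ht) fun _ ht' =>
    BFI.bumpC_eq_zero hY hM (Or.inr (le_of_lt ht'))

/-- **The rough cut-off `γ(q₀c)`** (`γ = BFI.bumpC S Y`, `0 < Y`, `0 ≤ S − Y`, `q₀ > 0`): at every
`c > 0`, `DerivBound (γ(q₀·)) c k (2·derivConstSum k) (((2S+Y)/Y)/c)`.  (Outside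
`[S−Y, 2S+Y]/q₀` the function vanishes near `c`; inside, `‖∂^i‖ ≤ 2 derivConstSum k (q₀/Y)^i` and
`q₀ ≤ (2S+Y)/c`.) [cite: Drappeau2017, §5.5] -/
theorem derivBound_bumpC_dilate {S Y : ℝ} (hY : 0 < Y) (hSY : 0 ≤ S - Y) {q₀ : ℝ} (hq₀ : 0 < q₀)
    (k : ℕ) {c : ℝ} (hc : 0 < c) :
    DerivBound (fun t => BFI.bumpC S Y (q₀ * t)) c k (2 * derivConstSum k) (((2 * S + Y) / Y) / c) := by
  have hS : 0 ≤ S := by linarith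
  have hX : 0 ≤ 2 * derivConstSum k := by linarith [one_le_derivConstSum k]
  have hu : 0 ≤ ((2 * S + Y) / Y) / c := by positivity
  by_cases hlo : q₀ * c < S - Y
  · refine DerivBound.of_eventuallyEq_zero ?_ k hX hu
    have hev : ∀ᶠ c' in 𝓝 c, q₀ * c' < S - Y :=
      ((continuous_const.mul continuous_id).continuousAt (x := c)).eventually (Iio_mem_nhds hlo)
    exact hev.mono fun c' hc' => BFI.bumpC_eq_zero hY hS (Or.inl hc'.le)
  by_cases hhi : 2 * S + Y < q₀ * c
  · refine DerivBound.of_eventuallyEq_zero ?_ k hX hu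
    have hev : ∀ᶠ c' in 𝓝 c, 2 * S + Y < q₀ * c' :=
      ((continuous_const.mul continuous_id).continuousAt (x := c)).eventually (Ioi_mem_nhds hhi)
    exact hev.mono fun c' hc' => BFI.bumpC_eq_zero hY hS (Or.inr hc'.le)
  -- inside: global bound and `q₀ ≤ (2S+Y)/c`
  have hq : q₀ ≤ (2 * S + Y) / c := by
    rw [le_div_iff₀ hc]; linarith [not_lt.1 hhi]
  have h := derivBound_comp_mul_pt (BFI.contDiff_bumpC S Y) q₀ c (derivBound_bumpC hY hS k (q₀ * c))
  refine h.mono le_rfl le_rfl ?_ hX (by positivity)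
  rw [abs_of_pos hq₀]
  calc q₀ * Y⁻¹ ≤ (2 * S + Y) / c * Y⁻¹ := mul_le_mul_of_nonneg_right hq (by positivity)
    _ = (2 * S + Y) / Y / c := by field_simp

/-- **The smooth cut-offs** `BFI.bumpC M (M/2)` (`M > 0`; `≡ 1` on `[M, 2M]`, supported in
`(M/2, 5M/2)`): at every `t > 0`, `DerivBound (bumpC M (M/2)) t k (2·derivConstSum k) (5/t)`.
[folklore] -/
theorem derivBound_bumpC_plateau {M : ℝ} (hM : 0 < M) (k : ℕ) {t : ℝ} (ht : 0 < t) :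
    DerivBound (BFI.bumpC M (M / 2)) t k (2 * derivConstSum k) (5 / t) := by
  have hY : 0 < M / 2 := by positivity
  have hX : 0 ≤ 2 * derivConstSum k := by linarith [one_le_derivConstSum k]
  by_cases hlo : t < M - M / 2
  · exact DerivBound.of_eventuallyEq_zero (bumpC_eventuallyEq_zero_of_lt hY hM.le hlo) k hX
      (by positivity)
  by_cases hhi : 2 * M + M / 2 < t
  · exact DerivBound.of_eventuallyEq_zero (bumpC_eventuallyEq_zero_of_gt hY hM.le hhi) k hX
      (by positivity)
  refine (derivBound_bumpC hY hM.le k t).mono le_rfl le_rfl ?_ hX (by positivity)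
  rw [le_div_iff₀ ht]
  have : t ≤ 2 * M + M / 2 := not_lt.1 hhi
  calc (M / 2)⁻¹ * t ≤ (M / 2)⁻¹ * (2 * M + M / 2) := mul_le_mul_of_nonneg_left this (by positivity)
    _ = 5 := by field_simp; ring

/-! ### The profile `α = BFI.bumpC 1 (1/2)` -/

/-- `α = bumpC 1 (1/2)` vanishes on `[5/2, ∞)`. [folklore] -/
theorem bumpC_one_half_eq_zero_of_ge {t : ℝ} (ht : 5 / 2 ≤ t) : BFI.bumpC 1 (1 / 2) t = 0 :=
  BFI.bumpC_eq_zero (by norm_num) zero_le_one (Or.inr (by linarith))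

/-- **Bounded derivatives of `t^m α^{(m)}`**: a family `MQ k ≥ 0` with
`‖(powDeriv α m)^{(l)}(t)‖ ≤ MQ k` for all `m, l ≤ k` and all `t` (`α = BFI.bumpC 1 (1/2)`).
[folklore] -/
theorem exists_MQ_bumpC :
    ∃ MQ : ℕ → ℝ, (∀ k, 0 ≤ MQ k) ∧ ∀ k m l : ℕ, m ≤ k → l ≤ k → ∀ t : ℝ,
      ‖iteratedDeriv l (powDeriv (BFI.bumpC 1 (1 / 2)) m) t‖ ≤ MQ k := by
  have hP : ContDiff ℝ ∞ (BFI.bumpC 1 (1 / 2)) := BFI.contDiff_bumpC 1 (1 / 2)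
  have hPs : HasCompactSupport (BFI.bumpC 1 (1 / 2)) :=
    BFI.hasCompactSupport_bumpC (by norm_num) zero_le_one
  have hmk : ∀ m k : ℕ, ∃ M : ℝ, 0 ≤ M ∧ ∀ l : ℕ, l ≤ k → ∀ t : ℝ,
      ‖iteratedDeriv l (powDeriv (BFI.bumpC 1 (1 / 2)) m) t‖ ≤ M := fun m k =>
    exists_bound_iteratedDeriv_of_hasCompactSupport (contDiff_powDeriv hP m)
      (hasCompactSupport_powDeriv hPs m) k
  choose M hM0 hM using hmk
  refine ⟨fun k => ∑ m ∈ Finset.range (k + 1), M m k, fun k => Finset.sum_nonneg fun m _ => hM0 m k,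
    fun k m l hm hl t => ?_⟩
  calc ‖iteratedDeriv l (powDeriv (BFI.bumpC 1 (1 / 2)) m) t‖ ≤ M m k := hM m k l hl t
    _ ≤ ∑ m ∈ Finset.range (k + 1), M m k :=
        Finset.single_le_sum (f := fun m => M m k) (fun m _ => hM0 m k)
          (Finset.mem_range.2 (by omega))

end KloostermanQuintilinear

end Literature.NumberTheory.Sieve

end
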